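import Literature.NumberTheory.Automorphic.ArchimedeanEnvelopingAction
import Literature.NumberTheory.Automorphic.ArchFlowParametricIntegral
import Literature.Algebra.Lie.EnvelopingAdInvariant
import HarnessLib

/-!
# Right ideals `𝔲·U(𝔤)` act by zero, through right Lie derivatives, on left-invariant functions

Topic `NumberTheory/Automorphic` (the analytic interface of the Levi step of Harish-Chandra's
finiteness theorem, Borel–Jacquet 1979, 4.3–4.4; Moeglin–Waldspurger 1995, I.2.17). Setting of
`ArchimedeanCalculus`: `H : RealMatrixGroup A N`, `ι : H → G` a homomorphism into a group, `φ : G → ℂ`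
acted on by non-commutative polynomials `p ∈ ℝ⟨𝔤⟩` through right Lie derivatives (`applyFree ι p φ`).

* `applyFree_apply_mul_left` (formal, any `H`; from `applyFree_comp_mul_left` of
  `ArchFlowParametricIntegral`) — **left invariance is preserved by the word action**: if
  `φ (s g) = φ g` for all `s ∈ S` then the same holds for every `p φ`.
* `lieDeriv_apply_eq_zero_of_conj_mem` (formal) — **a right Lie derivative `X φ` vanishes at `g`
  as soon as `g · exp(tX) · g⁻¹ ∈ S` for all `t` and `φ` is left `S`-invariant**
  (`φ (g exp tX) = φ ((g exp(tX) g⁻¹) g) = φ g`). For `G = GL_n(𝔸_K)`, `S = N(𝔸_K)` the unipotent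
  radical of a parabolic `P`, `X ∈ 𝔲 = Lie N(K_∞)` and `g` with `g_∞ ∈ P(K_∞)` this is the
  vanishing of `𝔲`-derivatives of constant terms along `P` at the points of `P(K_∞) × G(𝔸_f)`.
* `applyFree_apply_eq_zero_of_mem_rightSpan` (full linear group over a finite-dimensional
  coefficient algebra, smooth `φ`) — consequently **every `p ∈ ℝ⟨𝔤⟩` whose image in `U(𝔤)` lies in
  the right ideal `𝔲·U(𝔤)`** (the real span of the products `ι(X) a`, `X ∈ 𝔲`) **acts by zero at
  such points `g`** (the word action factors through `U(𝔤)` on smooth functions,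
  `applyFree_congr_of_top`). Combined with the monic relations
  `z^d + ∑ c_i z^i ∈ 𝔲·U` of `HarishChandraLeviIntegralReal` / `…Places` (`HCLevi.uRightR`) for the
  images `z` of central elements of the Levi blocks, this shows that such `z` act algebraically on the
  restrictions to `P(K_∞) × G(𝔸_f)` of left `N(𝔸)`-invariant smooth functions with a
  `Z(𝔤)`-character (Moeglin–Waldspurger I.2.17: the constant terms are `Z(𝔪)`-finite).
(The surjectivity `ℝ⟨𝔤⟩ → U(𝔤)` is used through a private copy of `freeToEnveloping_surjective` of
`AutomorphicRepsGLCuspidalSpectralSupport`, to keep the import closure light.)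

Everything here is proved: theorems only, no definition, no named fact.

## References

* A. Borel, H. Jacquet, *Automorphic forms and automorphic representations* (1979), §1.5, 4.3–4.4
  [BorelJacquet1979].
* C. Moeglin, J.-L. Waldspurger, *Spectral decomposition and Eisenstein series* (1995), I.2.17
  [MoeglinWaldspurger1995].
-/

-- Mathlib idiom (Mathlib/Algebra/Lie/OfAssociative.lean); needed to mention Lie subalgebras of matrix algebras
attribute [local instance 100] LieRing.ofAssociativeRing

noncomputable section

open scoped MatrixGroups Matrix ContDiff

namespace Literature.NumberTheory.Automorphic

variable {A : Type*} [NormedCommRing A] [NormedAlgebra ℝ A] [NormedAlgebra ℚ A] [CompleteSpace A]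
  [StarRing A] {N : Type*} [Fintype N] [DecidableEq N] {H : RealMatrixGroup A N}
  {G : Type*} [Group G] (ι : H.carrier →* G)

/-! ### Formal identities: left translations commute with the word action -/

section Formal

/-- **Left invariance is preserved by the word action**: if `φ (s g) = φ g` for all `s ∈ S` then
`(p φ) (s g) = (p φ) g`. [cite: BorelJacquet1979, §1.5] -/
theorem applyFree_apply_mul_left {S : Set G} {φ : G → ℂ} (hφ : ∀ s ∈ S, ∀ g, φ (s * g) = φ g)
    (p : FreeAlgebra ℝ H.lie) : ∀ s ∈ S, ∀ g, applyFree ι p φ (s * g) = applyFree ι p φ g := by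
  intro s hs g
  have h : (fun g ↦ φ (s * g)) = φ := funext (hφ s hs)
  have h2 := congrFun (applyFree_comp_mul_left ι p φ s) g
  rw [h] at h2
  exact h2.symm

/-- **A right Lie derivative of a left-invariant function vanishes where the one-parameter group is
conjugate into the invariance set**: if `φ (s g') = φ g'` for `s ∈ S` and
`g · ι(exp tX) · g⁻¹ ∈ S` for all `t`, then `(X φ)(g) = 0` (`φ (g exp tX) = φ g` is constant in `t`).
Moeglin–Waldspurger 1995, I.2.17 (the ideal `𝔲 U(𝔤)` acts by zero on functions on `U(𝔸)\G`).
[cite: MoeglinWaldspurger1995, I.2.17] -/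
theorem lieDeriv_apply_eq_zero_of_conj_mem {S : Set G} {φ : G → ℂ} (hφ : ∀ s ∈ S, ∀ g, φ (s * g) = φ g)
    (X : H.lie) {g : G} (hg : ∀ t : ℝ, g * ι (H.expMem (t • X)) * g⁻¹ ∈ S) : lieDeriv ι X φ g = 0 := by
  unfold lieDeriv
  have e : (fun t : ℝ ↦ φ (g * ι (H.expMem (t • X)))) = fun _ ↦ φ g := by
    funext t
    have h := hφ _ (hg t) g
    rwa [inv_mul_cancel_right] at h
  rw [e, deriv_const]

variable (H) in
/-- `ℝ⟨𝔤⟩ → U(𝔤)` is surjective (`U(𝔤)` is generated by `ι(𝔤)`). A PRIVATE copy of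
`freeToEnveloping_surjective` of `AutomorphicRepsGLCuspidalSpectralSupport` (whose import closure —
the cuspidal spectral theory — is far heavier than this file's; a librarian may move the public
survivor next to `freeToEnveloping` in `ArchimedeanCalculus`). Dixmier, *Enveloping Algebras*, 2.1.1.
[folklore] -/
private theorem freeToEnveloping_surjective_aux : Function.Surjective (freeToEnveloping H) := by
  intro u
  induction u using Literature.Algebra.Lie.UEnv.induction_on with
  | algebraMap r => exact ⟨algebraMap ℝ _ r, AlgHom.commutes _ r⟩
  | ι_mem x => exact ⟨FreeAlgebra.ι ℝ x, freeToEnveloping_ι x⟩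
  | mul a b ha hb =>
    obtain ⟨p, rfl⟩ := ha
    obtain ⟨q, rfl⟩ := hb
    exact ⟨p * q, map_mul _ p q⟩
  | add a b ha hb =>
    obtain ⟨p, rfl⟩ := ha
    obtain ⟨q, rfl⟩ := hb
    exact ⟨p + q, map_add _ p q⟩

end Formal

/-! ### Smooth functions: the right ideal `𝔲·U(𝔤)` acts by zero -/

section Smooth

variable [FiniteDimensional ℝ A]

/-- **`(X · p) φ` vanishes at `g`** for smooth left `S`-invariant `φ`, when `g exp(tX) g⁻¹ ∈ S` for
all `t` (full linear group: the word action factors through `U(𝔤)`, so `(X · p) φ = X (p φ)` with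
`p φ` again left `S`-invariant). [cite: MoeglinWaldspurger1995, I.2.17] -/
theorem applyFree_ι_mul_apply_eq_zero (hH : H.lie = ⊤) (hc : H.carrier = ⊤) {S : Set G} {φ : G → ℂ}
    (hφs : IsArchSmooth ι φ) (hφ : ∀ s ∈ S, ∀ g, φ (s * g) = φ g) (X : H.lie) (p : FreeAlgebra ℝ H.lie)
    {g : G} (hg : ∀ t : ℝ, g * ι (H.expMem (t • X)) * g⁻¹ ∈ S) :
    applyFree ι (FreeAlgebra.ι ℝ X * p) φ g = 0 := by
  rw [applyFree_ι_mul hH hc X p hφs]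
  exact lieDeriv_apply_eq_zero_of_conj_mem ι (applyFree_apply_mul_left ι hφ p) X hg

/-- **The right ideal `𝔲·U(𝔤)` acts by zero at `P`-points on left `N`-invariant smooth functions.**
Let `𝔲 ⊆ 𝔤` and `S ⊆ G` (think `𝔲 = Lie N(K_∞)`, `S = N(𝔸)`), `φ` smooth with `φ (s g') = φ g'`
for `s ∈ S`, and `g` such that `g · ι(exp tX) · g⁻¹ ∈ S` for all `X ∈ 𝔲`, `t ∈ ℝ` (think
`g_∞ ∈ P(K_∞)`). Then every `p ∈ ℝ⟨𝔤⟩` whose image in `U(𝔤)` lies in the right ideal `𝔲·U(𝔤)`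
(the real span of the products `ι(X) a`, `X ∈ 𝔲`, `a ∈ U(𝔤)`; e.g. the relations of
`HCLevi.uRightR` transported along `HCLevi.topEnvEquiv`) satisfies `(p φ)(g) = 0`.
Moeglin–Waldspurger 1995, I.2.17; Borel–Jacquet 1979, 4.4. [cite: MoeglinWaldspurger1995, I.2.17] -/
theorem applyFree_apply_eq_zero_of_mem_rightSpan (hH : H.lie = ⊤) (hc : H.carrier = ⊤) {S : Set G}
    {𝔲 : Set H.lie} {φ : G → ℂ} (hφs : IsArchSmooth ι φ) (hφ : ∀ s ∈ S, ∀ g, φ (s * g) = φ g) {g : G}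
    (hg : ∀ X ∈ 𝔲, ∀ t : ℝ, g * ι (H.expMem (t • X)) * g⁻¹ ∈ S) {p : FreeAlgebra ℝ H.lie}
    (hp : freeToEnveloping H p ∈ Submodule.span ℝ
      {w | ∃ X ∈ 𝔲, ∃ a : UniversalEnvelopingAlgebra ℝ H.lie, UniversalEnvelopingAlgebra.ι ℝ X * a = w}) :
    applyFree ι p φ g = 0 := by
  -- the statement for all preimages of elements of the right ideal
  suffices key : ∀ u ∈ Submodule.span ℝ
      {w | ∃ X ∈ 𝔲, ∃ a : UniversalEnvelopingAlgebra ℝ H.lie, UniversalEnvelopingAlgebra.ι ℝ X * a = w},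
      ∀ q : FreeAlgebra ℝ H.lie, freeToEnveloping H q = u → applyFree ι q φ g = 0 from key _ hp p rfl
  intro u hu
  induction hu using Submodule.span_induction with
  | mem u hu =>
    obtain ⟨X, hX, a, rfl⟩ := hu
    intro q hq
    obtain ⟨r, rfl⟩ := freeToEnveloping_surjective_aux H a
    have h : freeToEnveloping H q = freeToEnveloping H (FreeAlgebra.ι ℝ X * r) := by
      rw [hq, map_mul, freeToEnveloping_ι]
    rw [applyFree_congr_of_top ι hH hc h hφs]
    exact applyFree_ι_mul_apply_eq_zero ι hH hc hφs hφ X r (hg X hX)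
  | zero =>
    intro q hq
    have h : freeToEnveloping H q = freeToEnveloping H ((0 : ℝ) • 0) := by rw [hq, zero_smul, map_zero]
    rw [applyFree_congr_of_top ι hH hc h hφs, applyFree_smul_left, Complex.ofReal_zero, zero_smul, Pi.zero_apply]
  | add u v _ _ hu hv =>
    intro q hq
    obtain ⟨q₁, rfl⟩ := freeToEnveloping_surjective_aux H u
    obtain ⟨q₂, rfl⟩ := freeToEnveloping_surjective_aux H v
    have h : freeToEnveloping H q = freeToEnveloping H (q₁ + q₂) := by rw [hq, map_add]
    rw [applyFree_congr_of_top ι hH hc h hφs, applyFree_add, Pi.add_apply, hu q₁ rfl, hv q₂ rfl, add_zero]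
  | smul c u _ hu =>
    intro q hq
    obtain ⟨q₁, rfl⟩ := freeToEnveloping_surjective_aux H u
    have h : freeToEnveloping H q = freeToEnveloping H (c • q₁) := by rw [hq, map_smul]
    rw [applyFree_congr_of_top ι hH hc h hφs, applyFree_smul_left, Pi.smul_apply, hu q₁ rfl, smul_zero]

end Smooth

end Literature.NumberTheory.Automorphic
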